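/-
Literature anchor (engines group, cap lane, anchor #20): the quadratic-convolution estimates for
polynomially decaying Fourier tails behind the method of self-consistent bounds
(Zgliczyński–Mischaikow 2001 §3; Zgliczyński 2010 §3.1), with explicit constants, and the
integral-test bound for the tail of the `p`-series.
-/
import Mathlib
import Literature.Barriers.CriticalPhenomena.LongRangeTrivialityOnZ3LatticeSums
import HarnessLib

/-!
# Quadratic convolutions of polynomially decaying sequences (self-consistent bounds, tail part)

Topic `Literature/Analysis/ODE` (companion of `DissipativeTailIsolation.lean`, `GalerkinLimit.lean`,
`GalerkinCompactness.lean`).  A dissipative PDE with periodic boundary conditions and a quadratic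
nonlinearity, written in Fourier–Galerkin coordinates, has a vector field whose `k`-th component
contains the convolution `∑_j u_j v_{k-j}`.  The method of self-consistent bounds
(Zgliczyński–Mischaikow 2001) keeps explicit bounds `|u_j| ≤ a_j` for the LOW modes `|j| ≤ N`
and a polynomial ansatz `|u_j| ≤ C |j|^{-s}` (`s > 1`) for the TAIL `|j| > N`, and needs, for
every tail index `k`, a computable bound of the convolution.  This file proves the estimates with
explicit constants:

* `add_rpow_le_two_rpow_mul` — `(a + b)^γ ≤ 2^{γ-1} (a^γ + b^γ)` (`γ ≥ 1`; Zgliczyński 2010,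
  Lemma 3.2) and the KERNEL INEQUALITY `rpow_neg_mul_rpow_neg_le` it yields: if `c ≤ a + b` then
  `a^{-γ} b^{-γ} ≤ 2^{γ-1} c^{-γ} (a^{-γ} + b^{-γ})` (the proof of Zgliczyński 2010, Lemma 3.3;
  on `ℤ`: `int_kernel_le`, `|j|^{-s} |k-j|^{-s} ≤ 2^{s-1} |k|^{-s} (|j|^{-s} + |k-j|^{-s})`).
* `sum_abs_mul_le_of_decay` — TAIL × TAIL: if `|u_j| ≤ C_u |j|^{-s}` on `S` and
  `|v_j| ≤ C_v |j|^{-s}` on `T`, then for every finite set `J` of indices `j ∈ S` with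
  `k - j ∈ T`,
  `∑_{j ∈ J} |u_j| |v_{k-j}| ≤ 2^{s-1} C_u C_v |k|^{-s} (∑_J |j|^{-s} + ∑_J |k-j|^{-s})`;
  with `S = T = {|j| > N}` both sums are at most the tail `Z_N(s) = ∑_{|m| > N} |m|^{-s}` of the
  `p`-series over `ℤ` (`zetaTail`), whence `≤ 2^s C_u C_v |k|^{-s} Z_N(s)`
  (`sum_abs_mul_le_zetaTail`; Zgliczyński 2010, Lemma 3.3 restricted to the tails:
  `∑_{k₁} |k₁|^{-γ} |k-k₁|^{-γ} ≤ C_Q |k|^{-γ}` with `C_Q = 2^γ ∑ |k₁|^{-γ}`).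
* `sum_Ioc_rpow_neg_le`, `sum_abs_rpow_neg_le_of_tail`, `zetaTail_le` — the INTEGRAL TEST
  `∑_{n=N+1}^{K} n^{-s} ≤ (N+1)^{-s} + (N+1)^{1-s}/(s-1)` and
  `Z_N(s) ≤ 2 ((N+1)^{-s} + (N+1)^{1-s}/(s-1))`, built on the tree's
  `LongRangeIsing.sum_Ioc_rpow_neg_le` (`∑_{n=M+1}^{K} n^{-s} ≤ M^{1-s}/(s-1)`, the display used
  throughout ZM 2001 §3: `∑_{n>M} n^{-s} < ∫_M^∞ x^{-s} dx = 1/((s-1) M^{s-1})`).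
* `quadConv_abs_sum_le`, `quadConv_summable`, `quadConv_abs_tsum_le` — the full bound for a tail
  index `k ≠ 0` (ZM 2001 Lemmas 3.5–3.6 in the symmetric two-sided indexation):
  `∑_j |u_j| |v_{k-j}| ≤ LL(k) + LT(k) + TL(k) + 2^s C_u C_v |k|^{-s} Z_N(s)` with the finite,
  exactly computable sums `LL(k) = ∑_{|j| ≤ N, |k-j| ≤ N} a_j b_{k-j}`,
  `LT(k) = ∑_{|j| ≤ N, |k-j| > N} a_j C_v |k-j|^{-s}`,
  `TL(k) = ∑_{|k-j| ≤ N, |j| > N} C_u |j|^{-s} b_{k-j}`;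
  in particular the convolution series converges absolutely.

What this buys (cap lane): these are Lemma T2 (quadratic convolution tail: `LL + LT + TT`,
`TT ≤ C_u C_v · 2 · (2/|k|)^s · Z_N(s)` — the file's constant `2^s` is half of that) and the
`Z_N(s)` bound of a `cap-pde-cert` step, re-derived by the verifiers in exact rational arithmetic;
here they are theorems about the exact sums.  Lemma T1 (a dissipative linear mode) is
`DissipativeTailIsolation.lean`.  No facts, no axioms, no `sorry`.

## References

* P. Zgliczyński, K. Mischaikow, *Rigorous numerics for partial differential equations: the
  Kuramoto–Sivashinsky equation*, Found. Comput. Math. 1 (2001) 255–288, §3 (Lemmas 3.1, 3.5,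
  3.6 and the integral-test estimate after Lemma 3.1). [ZgliczynskiMischaikow2001; held:
  paper:arxiv-math_0005247, pp. 10–11]
* P. Zgliczyński, *Rigorous numerics for dissipative PDEs III. An effective algorithm for rigorous
  integration of dissipative PDEs*, Topol. Methods Nonlinear Anal. 36 (2010) 197–262, §3.1
  (Lemmas 3.2, 3.3, 3.4). [Zgliczynski2010; held: paper:w2601271310, p. 206]
* D. Wilczak, P. Zgliczyński, *Self-consistent bounds method for dissipative PDEs*,
  arXiv:2502.09760 (2025), §8 (polynomial bounds). [WilczakZgliczynski2025]
-/

noncomputable section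

open Real Set

namespace Literature.Analysis.ODE

/-! ### The kernel inequality -/

/-- Convexity of `x ↦ x^γ` (`γ ≥ 1`): `(a + b)^γ ≤ 2^{γ-1} (a^γ + b^γ)` for `a, b ≥ 0`.
[cite: Zgliczynski2010, §3.1 Lemma 3.2] -/
theorem add_rpow_le_two_rpow_mul {a b γ : ℝ} (ha : 0 ≤ a) (hb : 0 ≤ b) (hγ : 1 ≤ γ) :
    (a + b) ^ γ ≤ (2 : ℝ) ^ (γ - 1) * (a ^ γ + b ^ γ) := by
  lift a to NNReal using ha
  lift b to NNReal using hb
  exact_mod_cast NNReal.rpow_add_le_mul_rpow_add_rpow a b hγ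

/-- **The kernel inequality** (proof of Zgliczyński 2010, Lemma 3.3): if `a, b ≥ 0`, `c > 0`,
`c ≤ a + b` and `γ ≥ 1`, then `a^{-γ} b^{-γ} ≤ 2^{γ-1} c^{-γ} (a^{-γ} + b^{-γ})` (with the
convention `0^{-γ} = 0`).  Applied with `a = |k₁|`, `b = |k - k₁|`, `c = |k|`.
[cite: Zgliczynski2010, §3.1 Lemma 3.3 (proof)] -/
theorem rpow_neg_mul_rpow_neg_le {a b c γ : ℝ} (ha : 0 ≤ a) (hb : 0 ≤ b) (hc : 0 < c)
    (hcab : c ≤ a + b) (hγ : 1 ≤ γ) :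
    a ^ (-γ) * b ^ (-γ) ≤ (2 : ℝ) ^ (γ - 1) * c ^ (-γ) * (a ^ (-γ) + b ^ (-γ)) := by
  have hγ0 : (-γ) ≠ 0 := by intro h; linarith
  rcases ha.eq_or_lt with rfl | ha'
  · rw [Real.zero_rpow hγ0, zero_mul, zero_add]; positivity
  rcases hb.eq_or_lt with rfl | hb'
  · rw [Real.zero_rpow hγ0, mul_zero, add_zero]; positivity
  have hA : 0 < a ^ γ := Real.rpow_pos_of_pos ha' γ
  have hB : 0 < b ^ γ := Real.rpow_pos_of_pos hb' γ
  have hC : 0 < c ^ γ := Real.rpow_pos_of_pos hc γ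
  have key : c ^ γ ≤ (2 : ℝ) ^ (γ - 1) * (a ^ γ + b ^ γ) :=
    (Real.rpow_le_rpow hc.le hcab (by linarith)).trans (add_rpow_le_two_rpow_mul ha'.le hb'.le hγ)
  rw [Real.rpow_neg ha'.le, Real.rpow_neg hb'.le, Real.rpow_neg hc.le]
  have hA' : (a ^ γ) ≠ 0 := hA.ne'
  have hB' : (b ^ γ) ≠ 0 := hB.ne'
  have hC' : (c ^ γ) ≠ 0 := hC.ne'
  calc (a ^ γ)⁻¹ * (b ^ γ)⁻¹ = (a ^ γ)⁻¹ * (b ^ γ)⁻¹ * (c ^ γ)⁻¹ * c ^ γ := by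
        rw [mul_assoc ((a ^ γ)⁻¹ * (b ^ γ)⁻¹), inv_mul_cancel₀ hC', mul_one]
    _ ≤ (a ^ γ)⁻¹ * (b ^ γ)⁻¹ * (c ^ γ)⁻¹ * ((2 : ℝ) ^ (γ - 1) * (a ^ γ + b ^ γ)) := by
        gcongr
    _ = (2 : ℝ) ^ (γ - 1) * (c ^ γ)⁻¹ * ((a ^ γ)⁻¹ + (b ^ γ)⁻¹) := by
        field_simp
        ring

/-- The kernel inequality on `ℤ`: for `k ≠ 0`, `s ≥ 1` and every `j`,
`|j|^{-s} |k-j|^{-s} ≤ 2^{s-1} |k|^{-s} (|j|^{-s} + |k-j|^{-s})`.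
[cite: Zgliczynski2010, §3.1 Lemma 3.3 (proof)] -/
theorem int_kernel_le {s : ℝ} (hs : 1 ≤ s) {k : ℤ} (hk : k ≠ 0) (j : ℤ) :
    |(j : ℝ)| ^ (-s) * |((k - j : ℤ) : ℝ)| ^ (-s) ≤
      (2 : ℝ) ^ (s - 1) * |(k : ℝ)| ^ (-s) * (|(j : ℝ)| ^ (-s) + |((k - j : ℤ) : ℝ)| ^ (-s)) := by
  have hk' : 0 < |(k : ℝ)| := abs_pos.mpr (Int.cast_ne_zero.mpr hk)
  have htri : |(k : ℝ)| ≤ |(j : ℝ)| + |((k - j : ℤ) : ℝ)| := by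
    rw [Int.cast_sub]
    calc |(k : ℝ)| = |(j : ℝ) + ((k : ℝ) - j)| := by rw [add_sub_cancel]
      _ ≤ |(j : ℝ)| + |(k : ℝ) - j| := abs_add_le _ _
  exact rpow_neg_mul_rpow_neg_le (abs_nonneg _) (abs_nonneg _) hk' htri hs

/-! ### Tail × tail -/

/-- **Tail × tail convolution, finite form.** If `|u_j| ≤ C_u |j|^{-s}` for `j ∈ S` and
`|v_j| ≤ C_v |j|^{-s}` for `j ∈ T` (`s ≥ 1`, `k ≠ 0`), then for every finite set `J` of indices
with `j ∈ S`, `k - j ∈ T`: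
`∑_{j∈J} |u_j| |v_{k-j}| ≤ 2^{s-1} C_u C_v |k|^{-s} (∑_{j∈J} |j|^{-s} + ∑_{j∈J} |k-j|^{-s})`.
[cite: Zgliczynski2010, §3.1 Lemma 3.3] -/
theorem sum_abs_mul_le_of_decay {s : ℝ} (hs : 1 ≤ s) {k : ℤ} (hk : k ≠ 0) {u v : ℤ → ℝ}
    {Cu Cv : ℝ} (hCu : 0 ≤ Cu) (hCv : 0 ≤ Cv) {S T : Set ℤ}
    (hu : ∀ j ∈ S, |u j| ≤ Cu * |(j : ℝ)| ^ (-s))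
    (hv : ∀ j ∈ T, |v j| ≤ Cv * |(j : ℝ)| ^ (-s))
    (J : Finset ℤ) (hJ : ∀ j ∈ J, j ∈ S ∧ k - j ∈ T) :
    ∑ j ∈ J, |u j| * |v (k - j)| ≤ (2 : ℝ) ^ (s - 1) * Cu * Cv * |(k : ℝ)| ^ (-s) *
      (∑ j ∈ J, |(j : ℝ)| ^ (-s) + ∑ j ∈ J, |((k - j : ℤ) : ℝ)| ^ (-s)) := by
  have hterm : ∀ j ∈ J, |u j| * |v (k - j)| ≤ (2 : ℝ) ^ (s - 1) * Cu * Cv * |(k : ℝ)| ^ (-s) *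
      (|(j : ℝ)| ^ (-s) + |((k - j : ℤ) : ℝ)| ^ (-s)) := by
    intro j hj
    obtain ⟨hjS, hjT⟩ := hJ j hj
    have h1 := hu j hjS
    have h2 := hv (k - j) hjT
    have hker := int_kernel_le hs hk j
    calc |u j| * |v (k - j)| ≤ (Cu * |(j : ℝ)| ^ (-s)) * (Cv * |((k - j : ℤ) : ℝ)| ^ (-s)) :=
          mul_le_mul h1 h2 (abs_nonneg _) (by positivity)
      _ = Cu * Cv * (|(j : ℝ)| ^ (-s) * |((k - j : ℤ) : ℝ)| ^ (-s)) := by ring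
      _ ≤ Cu * Cv * ((2 : ℝ) ^ (s - 1) * |(k : ℝ)| ^ (-s) *
            (|(j : ℝ)| ^ (-s) + |((k - j : ℤ) : ℝ)| ^ (-s))) := by gcongr
      _ = _ := by ring
  calc ∑ j ∈ J, |u j| * |v (k - j)|
      ≤ ∑ j ∈ J, (2 : ℝ) ^ (s - 1) * Cu * Cv * |(k : ℝ)| ^ (-s) *
          (|(j : ℝ)| ^ (-s) + |((k - j : ℤ) : ℝ)| ^ (-s)) := Finset.sum_le_sum hterm
    _ = _ := by rw [← Finset.mul_sum, Finset.sum_add_distrib]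

/-- The tail of the `p`-series over `ℤ`: `Z_N(s) = ∑_{m ∈ ℤ, |m| > N} |m|^{-s}`.
[cite: ZgliczynskiMischaikow2001, §3 (the tail sums `∑_{n>M} n^{-s}`)] -/
def zetaTail (N : ℕ) (s : ℝ) : ℝ :=
  ∑' m : ℤ, {m : ℤ | (N : ℤ) < |m|}.indicator (fun m : ℤ => |(m : ℝ)| ^ (-s)) m

/-- The terms of `zetaTail` are nonnegative. [cite: ZgliczynskiMischaikow2001, §3] -/
theorem zetaTail_term_nonneg (N : ℕ) (s : ℝ) (m : ℤ) :
    0 ≤ {m : ℤ | (N : ℤ) < |m|}.indicator (fun m : ℤ => |(m : ℝ)| ^ (-s)) m :=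
  Set.indicator_nonneg (fun m _ => by positivity) m

/-- `Z_N(s) ≥ 0`. [cite: ZgliczynskiMischaikow2001, §3] -/
theorem zetaTail_nonneg (N : ℕ) (s : ℝ) : 0 ≤ zetaTail N s :=
  tsum_nonneg (zetaTail_term_nonneg N s)

/-- For `s > 1` the series defining `Z_N(s)` converges. [cite: ZgliczynskiMischaikow2001, §3] -/
theorem summable_zetaTail {s : ℝ} (hs : 1 < s) (N : ℕ) :
    Summable ({m : ℤ | (N : ℤ) < |m|}.indicator (fun m : ℤ => |(m : ℝ)| ^ (-s))) :=
  (Real.summable_abs_int_rpow hs).indicator _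

/-- Every finite partial sum of `|m|^{-s}` over tail indices `|m| > N` is at most `Z_N(s)`
(`s > 1`). [cite: ZgliczynskiMischaikow2001, §3] -/
theorem sum_rpow_neg_le_zetaTail {s : ℝ} (hs : 1 < s) (N : ℕ) (F : Finset ℤ)
    (hF : ∀ m ∈ F, (N : ℤ) < |m|) : ∑ m ∈ F, |(m : ℝ)| ^ (-s) ≤ zetaTail N s := by
  have hsum := summable_zetaTail hs N
  have h : ∑ m ∈ F, {m : ℤ | (N : ℤ) < |m|}.indicator (fun m : ℤ => |(m : ℝ)| ^ (-s)) m ≤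
      zetaTail N s := hsum.sum_le_tsum F (fun m _ => zetaTail_term_nonneg N s m)
  refine le_trans (le_of_eq (Finset.sum_congr rfl fun m hm => ?_)) h
  exact (Set.indicator_of_mem (show m ∈ {m : ℤ | (N : ℤ) < |m|} from hF m hm)
    (fun m : ℤ => |(m : ℝ)| ^ (-s))).symm

/-- **Tail × tail convolution bound** (Zgliczyński 2010, Lemma 3.3, restricted to the tails,
with the explicit constant): if `|u_j| ≤ C_u |j|^{-s}` and `|v_j| ≤ C_v |j|^{-s}` for `|j| > N`
(`s > 1`, `k ≠ 0`), then for every finite set `J` of indices with `|j| > N` and `|k - j| > N`,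
`∑_{j∈J} |u_j| |v_{k-j}| ≤ 2^s C_u C_v |k|^{-s} Z_N(s)`.
[cite: Zgliczynski2010, §3.1 Lemma 3.3] -/
theorem sum_abs_mul_le_zetaTail {s : ℝ} (hs : 1 < s) (N : ℕ) {k : ℤ} (hk : k ≠ 0)
    {u v : ℤ → ℝ} {Cu Cv : ℝ} (hCu : 0 ≤ Cu) (hCv : 0 ≤ Cv)
    (hu : ∀ j : ℤ, (N : ℤ) < |j| → |u j| ≤ Cu * |(j : ℝ)| ^ (-s))
    (hv : ∀ j : ℤ, (N : ℤ) < |j| → |v j| ≤ Cv * |(j : ℝ)| ^ (-s))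
    (J : Finset ℤ) (hJ : ∀ j ∈ J, (N : ℤ) < |j| ∧ (N : ℤ) < |k - j|) :
    ∑ j ∈ J, |u j| * |v (k - j)| ≤
      (2 : ℝ) ^ s * Cu * Cv * |(k : ℝ)| ^ (-s) * zetaTail N s := by
  have h := sum_abs_mul_le_of_decay hs.le hk hCu hCv (S := {j : ℤ | (N : ℤ) < |j|})
    (T := {j : ℤ | (N : ℤ) < |j|}) hu hv J hJ
  have h1 : ∑ j ∈ J, |(j : ℝ)| ^ (-s) ≤ zetaTail N s :=
    sum_rpow_neg_le_zetaTail hs N J (fun m hm => (hJ m hm).1)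
  have h2 : ∑ j ∈ J, |((k - j : ℤ) : ℝ)| ^ (-s) ≤ zetaTail N s := by
    have hinj : Set.InjOn (fun j : ℤ => k - j) ↑J := fun x _ y _ hxy => by simpa using hxy
    calc ∑ j ∈ J, |((k - j : ℤ) : ℝ)| ^ (-s)
        = ∑ m ∈ J.image (fun j : ℤ => k - j), |(m : ℝ)| ^ (-s) :=
          (Finset.sum_image (f := fun m : ℤ => |(m : ℝ)| ^ (-s)) hinj).symm
      _ ≤ zetaTail N s := sum_rpow_neg_le_zetaTail hs N _ (fun m hm => by
          obtain ⟨j, hj, rfl⟩ := Finset.mem_image.mp hm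
          exact (hJ j hj).2)
  have h2s : (2 : ℝ) ^ s = (2 : ℝ) ^ (s - 1) * 2 := by
    rw [← Real.rpow_add_one two_ne_zero, sub_add_cancel]
  calc ∑ j ∈ J, |u j| * |v (k - j)| ≤ _ := h
    _ ≤ (2 : ℝ) ^ (s - 1) * Cu * Cv * |(k : ℝ)| ^ (-s) * (zetaTail N s + zetaTail N s) := by
        gcongr
    _ = (2 : ℝ) ^ s * Cu * Cv * |(k : ℝ)| ^ (-s) * zetaTail N s := by rw [h2s]; ring

/-! ### The integral test for the tail of the `p`-series -/

/-- **Integral test** with the first term split off (no positivity assumption on `N`): for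
`s > 1`, `∑_{n=N+1}^{K} n^{-s} ≤ (N+1)^{-s} + (N+1)^{1-s}/(s-1)`.  The bare integral test
`∑_{n=M+1}^{K} n^{-s} ≤ M^{1-s}/(s-1)` (`M ≥ 1`) — the display `∑_{n>M} n^{-s} < ∫_M^∞ x^{-s} dx
= 1/((s-1)M^{s-1})` used throughout ZM 2001 §3 — is the tree's
`Literature.Barriers.CriticalPhenomena.LongRangeIsing.sum_Ioc_rpow_neg_le`, reused here.
[cite: ZgliczynskiMischaikow2001, §3 (integral-test estimate after Lemma 3.1)] -/
theorem sum_Ioc_rpow_neg_le {s : ℝ} (hs : 1 < s) (N K : ℕ) :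
    ∑ n ∈ Finset.Ioc N K, (n : ℝ) ^ (-s) ≤
      ((N + 1 : ℕ) : ℝ) ^ (-s) + ((N + 1 : ℕ) : ℝ) ^ (1 - s) / (s - 1) := by
  have hB1 : 0 ≤ ((N + 1 : ℕ) : ℝ) ^ (-s) := Real.rpow_nonneg (Nat.cast_nonneg _) _
  have hB2 : 0 ≤ ((N + 1 : ℕ) : ℝ) ^ (1 - s) / (s - 1) :=
    div_nonneg (Real.rpow_nonneg (Nat.cast_nonneg _) _) (by linarith)
  rcases lt_or_ge K (N + 1) with hK | hK
  · rw [Finset.Ioc_eq_empty (by omega), Finset.sum_empty]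
    positivity
  · rw [← Finset.sum_Ioc_consecutive _ (Nat.le_succ N) hK, Nat.Ioc_succ_singleton,
      Finset.sum_singleton]
    have := _root_.Literature.Barriers.CriticalPhenomena.LongRangeIsing.sum_Ioc_rpow_neg_le hs
      (M := N + 1) (by omega) K
    linarith

/-- Integral test for an arbitrary finite set of tail indices in `ℕ`: if every `n ∈ F` has
`n > N` then `∑_{n∈F} n^{-s} ≤ (N+1)^{-s} + (N+1)^{1-s}/(s-1)`.
[cite: ZgliczynskiMischaikow2001, §3 (integral-test estimate after Lemma 3.1)] -/
theorem sum_rpow_neg_le_of_tail {s : ℝ} (hs : 1 < s) (N : ℕ) (F : Finset ℕ)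
    (hF : ∀ n ∈ F, N < n) :
    ∑ n ∈ F, (n : ℝ) ^ (-s) ≤ ((N + 1 : ℕ) : ℝ) ^ (-s) + ((N + 1 : ℕ) : ℝ) ^ (1 - s) / (s - 1) := by
  have hsub : F ⊆ Finset.Ioc N (F.sup id) := by
    intro n hn
    rw [Finset.mem_Ioc]
    exact ⟨hF n hn, Finset.le_sup (f := id) hn⟩
  refine le_trans ?_ (sum_Ioc_rpow_neg_le hs N (F.sup id))
  exact Finset.sum_le_sum_of_subset_of_nonneg hsub (fun n _ _ => by positivity)

/-- The same over `ℤ` for positive tail indices: if every `m ∈ G` has `m > N`, then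
`∑_{m∈G} |m|^{-s} ≤ (N+1)^{-s} + (N+1)^{1-s}/(s-1)`.
[cite: ZgliczynskiMischaikow2001, §3 (integral-test estimate after Lemma 3.1)] -/
theorem sum_abs_rpow_neg_le_of_pos_tail {s : ℝ} (hs : 1 < s) (N : ℕ) (G : Finset ℤ)
    (hG : ∀ m ∈ G, (N : ℤ) < m) :
    ∑ m ∈ G, |(m : ℝ)| ^ (-s) ≤
      ((N + 1 : ℕ) : ℝ) ^ (-s) + ((N + 1 : ℕ) : ℝ) ^ (1 - s) / (s - 1) := by
  have hpos : ∀ m ∈ G, 0 ≤ m := fun m hm => le_trans (Int.natCast_nonneg N) (hG m hm).le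
  have hinj : Set.InjOn Int.toNat ↑G := by
    intro x hx y hy hxy
    rw [← Int.toNat_of_nonneg (hpos x hx), ← Int.toNat_of_nonneg (hpos y hy), hxy]
  have hcast : ∀ m ∈ G, |(m : ℝ)| ^ (-s) = ((m.toNat : ℕ) : ℝ) ^ (-s) := by
    intro m hm
    have hm0 := hpos m hm
    have : ((m.toNat : ℕ) : ℝ) = (m : ℝ) := by
      rw [← Int.cast_natCast, Int.toNat_of_nonneg hm0]
    rw [this, abs_of_nonneg (by exact_mod_cast hm0)]
  calc ∑ m ∈ G, |(m : ℝ)| ^ (-s) = ∑ m ∈ G, ((m.toNat : ℕ) : ℝ) ^ (-s) :=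
        Finset.sum_congr rfl hcast
    _ = ∑ n ∈ G.image Int.toNat, (n : ℝ) ^ (-s) :=
        (Finset.sum_image (f := fun n : ℕ => (n : ℝ) ^ (-s)) hinj).symm
    _ ≤ _ := sum_rpow_neg_le_of_tail hs N _ (fun n hn => by
        obtain ⟨m, hm, rfl⟩ := Finset.mem_image.mp hn
        exact Int.lt_toNat.mpr (hG m hm))

/-- Integral test over `ℤ`: if every `m ∈ F` has `|m| > N`, then
`∑_{m∈F} |m|^{-s} ≤ 2 ((N+1)^{-s} + (N+1)^{1-s}/(s-1))` (positive and negative indices).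
[cite: ZgliczynskiMischaikow2001, §3 (integral-test estimate after Lemma 3.1)] -/
theorem sum_abs_rpow_neg_le_of_tail {s : ℝ} (hs : 1 < s) (N : ℕ) (F : Finset ℤ)
    (hF : ∀ m ∈ F, (N : ℤ) < |m|) :
    ∑ m ∈ F, |(m : ℝ)| ^ (-s) ≤
      2 * (((N + 1 : ℕ) : ℝ) ^ (-s) + ((N + 1 : ℕ) : ℝ) ^ (1 - s) / (s - 1)) := by
  classical
  set B := ((N + 1 : ℕ) : ℝ) ^ (-s) + ((N + 1 : ℕ) : ℝ) ^ (1 - s) / (s - 1) with hB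
  rw [← Finset.sum_filter_add_sum_filter_not F (fun m : ℤ => 0 < m), two_mul]
  have hplus : ∑ m ∈ F.filter (fun m : ℤ => 0 < m), |(m : ℝ)| ^ (-s) ≤ B := by
    refine sum_abs_rpow_neg_le_of_pos_tail hs N _ (fun m hm => ?_)
    obtain ⟨hmF, hm0⟩ := Finset.mem_filter.mp hm
    have := hF m hmF
    rwa [abs_of_pos hm0] at this
  have hminus : ∑ m ∈ F.filter (fun m : ℤ => ¬ 0 < m), |(m : ℝ)| ^ (-s) ≤ B := by
    have hneg : ∀ m ∈ F.filter (fun m : ℤ => ¬ 0 < m), m < 0 := by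
      intro m hm
      obtain ⟨hmF, hm0⟩ := Finset.mem_filter.mp hm
      have h1 := hF m hmF
      rcases lt_trichotomy m 0 with h | h | h
      · exact h
      · subst h; simp at h1; omega
      · exact absurd h hm0
    have hinj : Set.InjOn (fun m : ℤ => -m) ↑(F.filter (fun m : ℤ => ¬ 0 < m)) :=
      fun x _ y _ hxy => by simpa using hxy
    calc ∑ m ∈ F.filter (fun m : ℤ => ¬ 0 < m), |(m : ℝ)| ^ (-s)
        = ∑ m ∈ F.filter (fun m : ℤ => ¬ 0 < m), |((-m : ℤ) : ℝ)| ^ (-s) :=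
          Finset.sum_congr rfl (fun m _ => by rw [Int.cast_neg, abs_neg])
      _ = ∑ m ∈ (F.filter (fun m : ℤ => ¬ 0 < m)).image (fun m : ℤ => -m), |(m : ℝ)| ^ (-s) :=
          (Finset.sum_image (f := fun m : ℤ => |(m : ℝ)| ^ (-s)) hinj).symm
      _ ≤ B := sum_abs_rpow_neg_le_of_pos_tail hs N _ (fun m hm => by
          obtain ⟨j, hj, rfl⟩ := Finset.mem_image.mp hm
          have h1 := hF j (Finset.mem_filter.mp hj).1
          have h2 := hneg j hj
          rw [abs_of_neg h2] at h1
          exact h1)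
  exact add_le_add hplus hminus

/-- **The `Z_N(s)` bound**: for `s > 1`, `Z_N(s) ≤ 2 ((N+1)^{-s} + (N+1)^{1-s}/(s-1))`.
[cite: ZgliczynskiMischaikow2001, §3 (integral-test estimate after Lemma 3.1)] -/
theorem zetaTail_le {s : ℝ} (hs : 1 < s) (N : ℕ) :
    zetaTail N s ≤ 2 * (((N + 1 : ℕ) : ℝ) ^ (-s) + ((N + 1 : ℕ) : ℝ) ^ (1 - s) / (s - 1)) := by
  classical
  refine Real.tsum_le_of_sum_le (zetaTail_term_nonneg N s) (fun F => ?_)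
  have hsplit : ∑ m ∈ F, {m : ℤ | (N : ℤ) < |m|}.indicator (fun m : ℤ => |(m : ℝ)| ^ (-s)) m =
      ∑ m ∈ F.filter (fun m : ℤ => (N : ℤ) < |m|), |(m : ℝ)| ^ (-s) := by
    rw [Finset.sum_filter]
    refine Finset.sum_congr rfl (fun m _ => ?_)
    simp only [Set.indicator_apply, Set.mem_setOf_eq]
  rw [hsplit]
  exact sum_abs_rpow_neg_le_of_tail hs N _ (fun m hm => (Finset.mem_filter.mp hm).2)

/-! ### The full bound for one tail index -/

/-- **Quadratic convolution with self-consistent bounds** (ZM 2001 Lemmas 3.5–3.6, two-sided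
indexation; Lemma T2 of a `cap.pde` step).  Let `|u_j| ≤ a_j`, `|v_j| ≤ b_j` for `|j| ≤ N` and
`|u_j| ≤ C_u |j|^{-s}`, `|v_j| ≤ C_v |j|^{-s}` for `|j| > N` (`s > 1`).  Then for `k ≠ 0` and
every finite `J ⊆ ℤ`,
`∑_{j∈J} |u_j| |v_{k-j}| ≤ LL(k) + LT(k) + TL(k) + 2^s C_u C_v |k|^{-s} Z_N(s)` with
`LL(k) = ∑_{|j|≤N, |k-j|≤N} a_j b_{k-j}`, `LT(k) = ∑_{|j|≤N, |k-j|>N} a_j C_v |k-j|^{-s}`,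
`TL(k) = ∑_{|k-j|≤N, |j|>N} C_u |j|^{-s} b_{k-j}`.
[cite: ZgliczynskiMischaikow2001, §3.2 Lemmas 3.5-3.6] -/
theorem quadConv_abs_sum_le {s : ℝ} (hs : 1 < s) (N : ℕ) {k : ℤ} (hk : k ≠ 0)
    {u v a b : ℤ → ℝ} {Cu Cv : ℝ} (hCu : 0 ≤ Cu) (hCv : 0 ≤ Cv)
    (ha : ∀ j : ℤ, |j| ≤ (N : ℤ) → |u j| ≤ a j) (hb : ∀ j : ℤ, |j| ≤ (N : ℤ) → |v j| ≤ b j)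
    (hu : ∀ j : ℤ, (N : ℤ) < |j| → |u j| ≤ Cu * |(j : ℝ)| ^ (-s))
    (hv : ∀ j : ℤ, (N : ℤ) < |j| → |v j| ≤ Cv * |(j : ℝ)| ^ (-s)) (J : Finset ℤ) :
    ∑ j ∈ J, |u j| * |v (k - j)| ≤
      (∑ j ∈ (Finset.Icc (-(N : ℤ)) N).filter (fun j => |k - j| ≤ (N : ℤ)), a j * b (k - j)) +
      (∑ j ∈ (Finset.Icc (-(N : ℤ)) N).filter (fun j => (N : ℤ) < |k - j|),
          a j * (Cv * |((k - j : ℤ) : ℝ)| ^ (-s))) +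
      (∑ j ∈ (Finset.Icc (k - N) (k + N)).filter (fun j => (N : ℤ) < |j|),
          Cu * |(j : ℝ)| ^ (-s) * b (k - j)) +
      (2 : ℝ) ^ s * Cu * Cv * |(k : ℝ)| ^ (-s) * zetaTail N s := by
  classical
  -- the four pieces of `J`
  set J₁ := J.filter (fun j : ℤ => |j| ≤ (N : ℤ)) with hJ₁
  set J₂ := J.filter (fun j : ℤ => ¬ |j| ≤ (N : ℤ)) with hJ₂
  set J₁₁ := J₁.filter (fun j : ℤ => |k - j| ≤ (N : ℤ)) with hJ₁₁
  set J₁₂ := J₁.filter (fun j : ℤ => ¬ |k - j| ≤ (N : ℤ)) with hJ₁₂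
  set J₂₁ := J₂.filter (fun j : ℤ => |k - j| ≤ (N : ℤ)) with hJ₂₁
  set J₂₂ := J₂.filter (fun j : ℤ => ¬ |k - j| ≤ (N : ℤ)) with hJ₂₂
  have hsplit : ∑ j ∈ J, |u j| * |v (k - j)| =
      (∑ j ∈ J₁₁, |u j| * |v (k - j)| + ∑ j ∈ J₁₂, |u j| * |v (k - j)|) +
      (∑ j ∈ J₂₁, |u j| * |v (k - j)| + ∑ j ∈ J₂₂, |u j| * |v (k - j)|) := by
    rw [Finset.sum_filter_add_sum_filter_not, Finset.sum_filter_add_sum_filter_not,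
      Finset.sum_filter_add_sum_filter_not]
  -- low × low
  have h11 : ∑ j ∈ J₁₁, |u j| * |v (k - j)| ≤
      ∑ j ∈ (Finset.Icc (-(N : ℤ)) N).filter (fun j => |k - j| ≤ (N : ℤ)), a j * b (k - j) := by
    have hmem : ∀ j ∈ J₁₁, |j| ≤ (N : ℤ) ∧ |k - j| ≤ (N : ℤ) := fun j hj => by
      simp only [hJ₁₁, hJ₁, Finset.mem_filter] at hj
      exact ⟨hj.1.2, hj.2⟩
    calc ∑ j ∈ J₁₁, |u j| * |v (k - j)| ≤ ∑ j ∈ J₁₁, a j * b (k - j) :=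
          Finset.sum_le_sum (fun j hj => mul_le_mul (ha j (hmem j hj).1) (hb _ (hmem j hj).2)
            (abs_nonneg _) ((abs_nonneg _).trans (ha j (hmem j hj).1)))
      _ ≤ _ := by
          refine Finset.sum_le_sum_of_subset_of_nonneg (fun j hj => ?_) (fun j hj _ => ?_)
          · obtain ⟨h1, h2⟩ := hmem j hj
            simp only [Finset.mem_filter, Finset.mem_Icc]
            exact ⟨abs_le.mp h1, h2⟩
          · simp only [Finset.mem_filter, Finset.mem_Icc] at hj
            exact mul_nonneg ((abs_nonneg _).trans (ha j (abs_le.mpr hj.1)))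
              ((abs_nonneg _).trans (hb _ hj.2))
  -- low × tail
  have h12 : ∑ j ∈ J₁₂, |u j| * |v (k - j)| ≤
      ∑ j ∈ (Finset.Icc (-(N : ℤ)) N).filter (fun j => (N : ℤ) < |k - j|),
        a j * (Cv * |((k - j : ℤ) : ℝ)| ^ (-s)) := by
    have hmem : ∀ j ∈ J₁₂, |j| ≤ (N : ℤ) ∧ (N : ℤ) < |k - j| := fun j hj => by
      simp only [hJ₁₂, hJ₁, Finset.mem_filter, not_le] at hj
      exact ⟨hj.1.2, hj.2⟩
    calc ∑ j ∈ J₁₂, |u j| * |v (k - j)| ≤ ∑ j ∈ J₁₂, a j * (Cv * |((k - j : ℤ) : ℝ)| ^ (-s)) :=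
          Finset.sum_le_sum (fun j hj => mul_le_mul (ha j (hmem j hj).1) (hv _ (hmem j hj).2)
            (abs_nonneg _) ((abs_nonneg _).trans (ha j (hmem j hj).1)))
      _ ≤ _ := by
          refine Finset.sum_le_sum_of_subset_of_nonneg (fun j hj => ?_) (fun j hj _ => ?_)
          · obtain ⟨h1, h2⟩ := hmem j hj
            simp only [Finset.mem_filter, Finset.mem_Icc]
            exact ⟨abs_le.mp h1, h2⟩
          · simp only [Finset.mem_filter, Finset.mem_Icc] at hj
            exact mul_nonneg ((abs_nonneg _).trans (ha j (abs_le.mpr hj.1))) (by positivity)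
  -- tail × low
  have h21 : ∑ j ∈ J₂₁, |u j| * |v (k - j)| ≤
      ∑ j ∈ (Finset.Icc (k - N) (k + N)).filter (fun j => (N : ℤ) < |j|),
        Cu * |(j : ℝ)| ^ (-s) * b (k - j) := by
    have hmem : ∀ j ∈ J₂₁, (N : ℤ) < |j| ∧ |k - j| ≤ (N : ℤ) := fun j hj => by
      simp only [hJ₂₁, hJ₂, Finset.mem_filter, not_le] at hj
      exact ⟨hj.1.2, hj.2⟩
    calc ∑ j ∈ J₂₁, |u j| * |v (k - j)| ≤ ∑ j ∈ J₂₁, Cu * |(j : ℝ)| ^ (-s) * b (k - j) :=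
          Finset.sum_le_sum (fun j hj => mul_le_mul (hu j (hmem j hj).1) (hb _ (hmem j hj).2)
            (abs_nonneg _) (by positivity))
      _ ≤ _ := by
          refine Finset.sum_le_sum_of_subset_of_nonneg (fun j hj => ?_) (fun j hj _ => ?_)
          · obtain ⟨h1, h2⟩ := hmem j hj
            simp only [Finset.mem_filter, Finset.mem_Icc]
            obtain ⟨h3, h4⟩ := abs_le.mp h2
            exact ⟨⟨by linarith, by linarith⟩, h1⟩
          · simp only [Finset.mem_filter, Finset.mem_Icc] at hj
            have h2 : |k - j| ≤ (N : ℤ) := abs_le.mpr ⟨by linarith [hj.1.1, hj.1.2], by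
              linarith [hj.1.1, hj.1.2]⟩
            exact mul_nonneg (by positivity) ((abs_nonneg _).trans (hb _ h2))
  -- tail × tail
  have h22 : ∑ j ∈ J₂₂, |u j| * |v (k - j)| ≤
      (2 : ℝ) ^ s * Cu * Cv * |(k : ℝ)| ^ (-s) * zetaTail N s :=
    sum_abs_mul_le_zetaTail hs N hk hCu hCv hu hv J₂₂ (fun j hj => by
      simp only [hJ₂₂, hJ₂, Finset.mem_filter, not_le] at hj
      exact ⟨hj.1.2, hj.2⟩)
  rw [hsplit]
  linarith [h11, h12, h21, h22]

/-- Under the hypotheses of `quadConv_abs_sum_le` the convolution series `∑_j u_j v_{k-j}`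
converges absolutely. [cite: ZgliczynskiMischaikow2001, §3.2 Lemmas 3.5-3.6] -/
theorem quadConv_summable {s : ℝ} (hs : 1 < s) (N : ℕ) {k : ℤ} (hk : k ≠ 0)
    {u v a b : ℤ → ℝ} {Cu Cv : ℝ} (hCu : 0 ≤ Cu) (hCv : 0 ≤ Cv)
    (ha : ∀ j : ℤ, |j| ≤ (N : ℤ) → |u j| ≤ a j) (hb : ∀ j : ℤ, |j| ≤ (N : ℤ) → |v j| ≤ b j)
    (hu : ∀ j : ℤ, (N : ℤ) < |j| → |u j| ≤ Cu * |(j : ℝ)| ^ (-s))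
    (hv : ∀ j : ℤ, (N : ℤ) < |j| → |v j| ≤ Cv * |(j : ℝ)| ^ (-s)) :
    Summable (fun j : ℤ => |u j| * |v (k - j)|) ∧ Summable (fun j : ℤ => u j * v (k - j)) := by
  have h1 : Summable (fun j : ℤ => |u j| * |v (k - j)|) :=
    summable_of_sum_le (fun j => by positivity)
      (fun J => quadConv_abs_sum_le hs N hk hCu hCv ha hb hu hv J)
  exact ⟨h1, h1.of_norm_bounded (fun j => by rw [Real.norm_eq_abs, abs_mul])⟩

/-- **The convolution bound at a tail index** (ZM 2001 Lemmas 3.5–3.6 / Lemma T2): under the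
hypotheses of `quadConv_abs_sum_le`,
`|∑_{j∈ℤ} u_j v_{k-j}| ≤ LL(k) + LT(k) + TL(k) + 2^s C_u C_v |k|^{-s} Z_N(s)`.
[cite: ZgliczynskiMischaikow2001, §3.2 Lemmas 3.5-3.6] -/
theorem quadConv_abs_tsum_le {s : ℝ} (hs : 1 < s) (N : ℕ) {k : ℤ} (hk : k ≠ 0)
    {u v a b : ℤ → ℝ} {Cu Cv : ℝ} (hCu : 0 ≤ Cu) (hCv : 0 ≤ Cv)
    (ha : ∀ j : ℤ, |j| ≤ (N : ℤ) → |u j| ≤ a j) (hb : ∀ j : ℤ, |j| ≤ (N : ℤ) → |v j| ≤ b j)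
    (hu : ∀ j : ℤ, (N : ℤ) < |j| → |u j| ≤ Cu * |(j : ℝ)| ^ (-s))
    (hv : ∀ j : ℤ, (N : ℤ) < |j| → |v j| ≤ Cv * |(j : ℝ)| ^ (-s)) :
    |∑' j : ℤ, u j * v (k - j)| ≤
      (∑ j ∈ (Finset.Icc (-(N : ℤ)) N).filter (fun j => |k - j| ≤ (N : ℤ)), a j * b (k - j)) +
      (∑ j ∈ (Finset.Icc (-(N : ℤ)) N).filter (fun j => (N : ℤ) < |k - j|),
          a j * (Cv * |((k - j : ℤ) : ℝ)| ^ (-s))) +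
      (∑ j ∈ (Finset.Icc (k - N) (k + N)).filter (fun j => (N : ℤ) < |j|),
          Cu * |(j : ℝ)| ^ (-s) * b (k - j)) +
      (2 : ℝ) ^ s * Cu * Cv * |(k : ℝ)| ^ (-s) * zetaTail N s := by
  have hsum := (quadConv_summable hs N hk hCu hCv ha hb hu hv).1
  rw [← Real.norm_eq_abs]
  refine (norm_tsum_le_tsum_norm ?_).trans ?_
  · simpa only [Real.norm_eq_abs, abs_mul] using hsum
  · simp only [Real.norm_eq_abs, abs_mul]
    exact Real.tsum_le_of_sum_le (fun j => by positivity)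
      (fun J => quadConv_abs_sum_le hs N hk hCu hCv ha hb hu hv J)

end Literature.Analysis.ODE
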